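import Summits.CriticalPhenomena.PercolationContinuityZ3.Theorems.Transplant.SkelFrm1RootHoldsQ3VR
import Summits.CriticalPhenomena.PercolationContinuityZ3.Theorems.Transplant.SkelFrmBChoiceResidQV
import Summits.CriticalPhenomena.PercolationContinuityZ3.Theorems.Transplant.SkelFrmBChoiceRootReadDischarge
import Summits.CriticalPhenomena.PercolationContinuityZ3.Theorems.Transplant.SkelFrmBChoiceRows
import Summits.CriticalPhenomena.PercolationContinuityZ3.Theorems.Transplant.SkelFrmBChoiceRoomV
import Summits.CriticalPhenomena.PercolationContinuityZ3.Theorems.Transplant.SkelFrmBChoiceCreep2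
import HarnessLib

/-!
# N2 (frames-only node `SamePDropOfSkeletonFrm₁`, OPEN), (R) column: **THE (R) COLUMN PROP AT THE NODE TUPLE OF RECORD** —
# `rootHoldsNQWFnLK_frmChoiceAllQ3V_node (Kmin mk) (hKmin : 200 ≤ Kmin) (mxR) :`
# `RootHoldsNQWFnLK LfQ Kmin (frmChoiceAllQ3V (KS.gT mk (gxQ mk (gxR0 mk) (fxR mk))) (KS.fT mk (fxQ mk (fxR mk))) (KS.PR mk (PxQ mk (PxR mk)))`
# `(SUS (exQ mk (exR0 mk)) (mxQ mxR)) (cR2W mk) (hFR mk) BSlot.small3)`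

The (R) legs' wrapper `rootHoldsNQWFnLK_frmChoiceAllQ3V_R` (SkelFrm1RootHoldsQ3VR) with its hypotheses discharged at the tuple of record (J23/(R-44)/(R-45),
instance (76·s₀, 19·s₁ | c0 + 5s₁ + 2, c1 + 54s₀ + 2), era-3 windows): slot dominations from stmt's residual unions (SkelFrmBChoiceResidQV:
`le_gT_gxQ`, `two_fT_le_gT`, `le_fT_fxQ`, `le_exQ`, `subset_PR_PxQ`; ResidC `gxC_floors`) over the (R) residuals `gxR0/fxR/exR0/PxR`
(SkelFrmBChoiceResidR), `hRs5` from `RA'_le_r_TA` (SkelFrmBChoiceRows) + `KS.T₀a_lt_RA'`, and the four root reading rows `NegB.rowX1_Q/rowXA_Q/rowX2_Q/rowYA_Q`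
(stmt-g22, SkelFrmBChoiceRootReadDischarge) at `cOf … (cR2W mk) = cR2vW … mk`, `bOf … small3 = small3 …` (`cOf_cR2W`, `bOf_small3_eq`).
The rim-diameter residual `mxR` stays a parameter (the (R) side holds for every `mx`; the (F) column's demand goes there).
NON-VACUITY (lead g11 standing order): every hypothesis discharged; the K-floor `200 ≤ Kmin` is node₂'s `Kmin := 200`.
builds on p205010 (kernel theorem, internal audit signed; external expert review pending) — nothing in this file uses p205010; NOTHING is claimed
about the open node `SamePDropOfSkeletonFrm₁`.
Lane `prim-bschramm`, seat `prim-bschramm-p3` (gen 18; N2 design owner, (R) column owner, node₂ pen); helper file (`--supports stmt-CriticalPhenomena-4575 --as helper`).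
[cite: KozmaNitzan2024, §4 p. 28 ((32) at the root), Theorem 6 (pp. 25–31)]
-/

noncomputable section

open scoped Classical

namespace Summit.CriticalPhenomena.PercolationContinuityZ3.Theorems.Transplant

open MeasureTheory Literature.Probability.Percolation Literature.Probability.LatticeModels SimpleGraph KNCells KNLevels
open SkelConc (Consts)
open Skelφ.StepI (DataN DataNS OutNS)

namespace PlanarSkeletonFrm

namespace NegB

open Neg

set_option maxHeartbeats 800000 in
/-- **THE (R) COLUMN PROP AT THE NODE TUPLE OF RECORD** (see the module docstring). [cite: KozmaNitzan2024, §4 p. 28 ((32) at the root)] -/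
theorem rootHoldsNQWFnLK_frmChoiceAllQ3V_node (Kmin mk : ℕ) (hKmin : 200 ≤ Kmin) (mxR : GSlot) :
    RootHoldsNQWFnLK LfQ Kmin (frmChoiceAllQ3V (KS.gT mk (gxQ mk (gxR0 mk) (fxR mk))) (KS.fT mk (fxQ mk (fxR mk))) (KS.PR mk (PxQ mk (PxR mk)))
      (SUS (exQ mk (exR0 mk)) (mxQ mxR)) (cR2W mk) (hFR mk) BSlot.small3) := by
  refine rootHoldsNQWFnLK_frmChoiceAllQ3V_R Kmin mk hKmin (KS.gT mk (gxQ mk (gxR0 mk) (fxR mk))) (KS.fT mk (fxQ mk (fxR mk))) (KS.PR mk (PxQ mk (PxR mk))) (exQ mk (exR0 mk)) (mxQ mxR) (cR2W mk) (hFR mk) BSlot.small3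
    ?_ ?_ ?_ ?_ ?_ ?_ ?_ ?_ ?_
  · -- HgR
    intro κ V _ _ G _ Φ t p D
    obtain ⟨h1, -, h3⟩ := le_gT_gxQ mk (gxR0 mk) (fxR mk) κ Φ t p D
    obtain ⟨g1, g2, -⟩ := gxC_floors κ Φ t p D mk
    exact ⟨g1.trans h1, g2.trans h1, h3, two_fT_le_gT mk (gxR0 mk) (fxR mk) κ Φ t p D⟩
  · -- HfR
    intro κ V _ _ G _ Φ t p D
    exact (le_fT_fxQ mk (fxR mk) κ Φ t p D).2.2
  · -- HexR
    intro κ V _ _ G _ Φ t p D g f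
    exact (le_exQ mk (exR0 mk) κ Φ t p D g f).2.2.2.2
  · -- HPx
    intro κ V _ _ G _ Φ t p D
    exact (subset_PR_PxQ mk κ Φ t p D (PxR mk)).1
  · -- HRs
    intro κ V _ _ G _ Φ t p D f hN hκ i
    have h1 := RA'_le_r_TA κ Φ t p D mk (gxQ mk (gxR0 mk) (fxR mk)) f hN hκ i
    have h2 := (KS.T₀a_lt_RA' κ Φ t p D mk).2.1
    have h3 : ((KS.Rs t D mk : ℕ) : ℤ) + 2 < ((fcellsA κ Φ t p D ((KS.gT mk (gxQ mk (gxR0 mk) (fxR mk))) κ Φ t p D) f).r i : ℤ) := lt_of_lt_of_le (by exact_mod_cast h2) h1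
    omega
  · -- HX1
    intro κ V _ _ G _ Φ t p hC O q hK hAt
    have hN := eqNumL_of_atQ (atQ3_of_atQ3V hAt)
    obtain ⟨h1, -, -⟩ := le_gT_gxQ mk (gxR0 mk) (fxR mk) κ Φ t p O.merged
    obtain ⟨g1, g2, -⟩ := gxC_floors κ Φ t p O.merged mk
    exact rowX1_Q κ Φ t p O.merged _ _ mk (PlanarSkeletonNeg.Neg.kq_ge_of_le κ (m := 4) (le_trans (by norm_num) hK)) hN (g1.trans h1) (g2.trans h1)
  · -- HXA
    intro κ V _ _ G _ Φ t p hC O q hK hAt hg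
    have hN := eqNumL_of_atQ (atQ3_of_atQ3V hAt)
    obtain ⟨h1, -, -⟩ := le_gT_gxQ mk (gxR0 mk) (fxR mk) κ Φ t p O.merged
    obtain ⟨-, g2, -⟩ := gxC_floors κ Φ t p O.merged mk
    have r := rowXA_Q κ Φ t p O.merged (gOf κ Φ t p O (KS.gT mk (gxQ mk (gxR0 mk) (fxR mk)))) (fOf κ Φ t p O (KS.fT mk (fxQ mk (fxR mk)))) mk
      (PlanarSkeletonNeg.Neg.kq_ge_of_le κ (m := 4) (le_trans (by norm_num) hK)) hN hg (g2.trans h1)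
    have e := bOf_small3_eq κ Φ t p O (KS.gT mk (gxQ mk (gxR0 mk) (fxR mk))) (KS.fT mk (fxQ mk (fxR mk)))
    rw [← e] at r
    exact r
  · -- HX2
    intro κ V _ _ G _ Φ t p hC O q hK hAt
    have hN := eqNumL_of_atQ (atQ3_of_atQ3V hAt)
    obtain ⟨h1, -, -⟩ := le_gT_gxQ mk (gxR0 mk) (fxR mk) κ Φ t p O.merged
    obtain ⟨g1, g2, -⟩ := gxC_floors κ Φ t p O.merged mk
    exact rowX2_Q κ Φ t p O.merged _ _ mk hN (g1.trans h1) (g2.trans h1)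
  · -- HYA
    intro κ V _ _ G _ Φ t p hC O q hK hAt hg
    have hN := eqNumL_of_atQ (atQ3_of_atQ3V hAt)
    obtain ⟨h1, -, -⟩ := le_gT_gxQ mk (gxR0 mk) (fxR mk) κ Φ t p O.merged
    obtain ⟨-, g2, -⟩ := gxC_floors κ Φ t p O.merged mk
    have r := rowYA_Q κ Φ t p O.merged (gOf κ Φ t p O (KS.gT mk (gxQ mk (gxR0 mk) (fxR mk)))) (fOf κ Φ t p O (KS.fT mk (fxQ mk (fxR mk)))) mk
      (PlanarSkeletonNeg.Neg.kq_ge_of_le κ (m := 4) (le_trans (by norm_num) hK)) hN hg (g2.trans h1)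
    have e := bOf_small3_eq κ Φ t p O (KS.gT mk (gxQ mk (gxR0 mk) (fxR mk))) (KS.fT mk (fxQ mk (fxR mk)))
    rw [← e] at r
    exact r

end NegB

end PlanarSkeletonFrm

end Summit.CriticalPhenomena.PercolationContinuityZ3.Theorems.Transplant

end
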